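import Summits.QuantumFields.BalabanUV.Beta.RemainderExplicitMultiplier
import Literature.MathematicalPhysics.QuantumFieldTheory.Balaban1983to89.Beta.ResolventComposition

/-!
# Beta / RemainderExplicitLaplacian — BINDER-OWNERS row D4, ROAD P3 (co-owner #3, unit `b2b-balaban-beta-d4-p3`), skeleton leaf E3.3,
# SECOND THIRD: `d*d` OF THE TYPED `U = 1` MINIMISER COLUMN IS `O(N^{−(d+2)}·N^{−2})` POINTWISE WITH BLOCK-SCALE DECAY, LEVEL-UNIFORMLY —
# `|curvAdj (curv wH-column) μ x| ≤ C · (N^5)⁻¹ · (N^2)⁻¹ · e^{−κ₀‖quo_N x‖∞}`, `N = Lc^{j+1}`, `d + 1 = 4`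

HONEST FRAMING (page 1 of everything the β sub-cell writes): discharging `BetaPertH` makes Bałaban's UV stability
UNCONDITIONAL — a real constructive-QFT result; it is NOT the continuum limit and NOT the Clay problem.  HONEST DEPENDENCY
(verbatim): «continuum YM on T⁴ ⇐ BetaPertH ∧ nine spine estimates (0/9 proved); BetaPertH ⇐ (D1) ∧ (D4) ∧ CAP+tail;
G-an2-4 gates asym, D1 and NE2/3/4.»  NOT IN PRINT; OUR BOOKKEEPING.  `[folklore]`: the GAUGE-FREE Euler–Lagrange identity of the
typed KKT system (an5's `ResolventComposition.wH_EL'`: `d*d wH = 𝒬ᵀ wΦ` — the gauge multiplier VANISHES, `wM_eq_zero`) composed with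
the level-uniform multiplier bound of road P3's `RemainderExplicitMultiplier.exists_wΦ_decay` (`|wΦ| ≤ C·N^{−5}·N^{−3}·e^{−κ₀‖y‖∞}`):
the un-normalised adjoint block sum `𝒬ᵀ` adds `N` coarse values read at blocks within sup-distance `1` of `quo_N x`.  No cited fact,
no wall binder; nothing about Bałaban's densities is asserted.  NOT summit progress.

ABSOLUTE RULE (cell charter, verbatim): "No internally-minted statement may enter as a cited fact. Every hypothesis is
either kernel-proved in this package or a verbatim quotation of a PUBLISHED theorem with page reference. The manuscript(s)
under audit are NOT citable for their own disputed steps — they are the thing under adjudication; programme-internal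
(2001/route/tribunal) claims are never citable."

## Why road P3 wants this (skeleton `HOME/beta/skeletons/D4-b2b-balaban-beta-d4-p3.md` §3 leaf E3.3; units note `UNITS-E4.md` §5)

[Balaban1987RG1] p. 272: «we replace the operator D*D by D*D + DRD* = D*D + DD* − DPD* = Δ^ξ_U − P₁ + (lower order, local operator)»; for
a configuration in the weak Landau gauge `DRD*𝐀 = 0`, so `(Δ − P₁)𝐀 = D*D𝐀`.  For road P3's test configuration `h = N^{d+2}·wH^{(N)}` (d + 1
= 4) the `|Δ^η_U𝐀 − P₁𝐀|_X`-type component of the (3.14)/(4.4) norm is `N²·N^5·|d*d wH|` in fine units; this file proves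
`|d*d wH| ≲ N^{−5}·N^{−2}` level-uniformly, i.e. that component is LEVEL-FREE.  (The third third, `|P₁h| = N²·N^5·|dd* wH|`, is a
separate leaf.)
-/

noncomputable section

open Finset
open scoped BigOperators
open Literature.MathematicalPhysics.QuantumFieldTheory.LatticeForm (quo)
open Literature.MathematicalPhysics.QuantumFieldTheory.Balaban1983to89
open Literature.MathematicalPhysics.QuantumFieldTheory.Balaban1983to89.Beta
open AffineAveraging (Site Form1 unitVec unitVec_apply curv curvAdj)
open AffineReproduction (contourSumAdj)
open B4ContourShift (supNorm supNorm_nonneg)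
open KernelSpecInstance (wH wΦ)
open ResolventComposition (wH_EL')
open Summit.QuantumFields.BalabanUV.Beta.RemainderExplicitMultiplier (exists_wΦ_decay)

namespace Summit.QuantumFields.BalabanUV.Beta.RemainderExplicitLaplacian

variable {d : ℕ}

/-! ## §1 Block labels along a straight contour stay within sup-distance one -/

/-- [folklore] Floor division by `N ≥ 1` moves by at most one when the numerator drops by `s ∈ [0, N)`:
`x/N − 1 ≤ (x − s)/N ≤ x/N`. -/
theorem ediv_sub_bounds {N : ℕ} (hN : 0 < N) {s : ℕ} (hs : s < N) (x : ℤ) :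
    x / (N : ℤ) - 1 ≤ (x - (s : ℤ)) / (N : ℤ) ∧ (x - (s : ℤ)) / (N : ℤ) ≤ x / (N : ℤ) := by
  have hN' : (0 : ℤ) < N := by exact_mod_cast hN
  refine ⟨?_, Int.ediv_le_ediv hN' (by linarith [Int.natCast_nonneg s])⟩
  have h1 : (x - (N : ℤ)) / (N : ℤ) = x / (N : ℤ) - 1 := by
    rw [show x - (N : ℤ) = x + (-1) * (N : ℤ) by ring, Int.add_mul_ediv_right _ _ hN'.ne']
    ring
  rw [← h1]
  have hsN : (s : ℤ) ≤ N := by exact_mod_cast hs.le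
  exact Int.ediv_le_ediv hN' (by linarith)

/-- [folklore] **The block of `x − s·e_κ` (`0 ≤ s < N`) is within sup-distance `1` of the block of `x`**, in the form the decay
bookkeeping uses: `‖quo_N x‖∞ ≤ ‖quo_N (x − s·e_κ)‖∞ + 1`. -/
theorem supNorm_quo_le_succ {N : ℕ} (hN : 0 < N) {s : ℕ} (hs : s < N) (x : Site (d + 1)) (κ : Fin (d + 1)) :
    supNorm (quo N x) ≤ supNorm (quo N (x - (s : ℤ) • unitVec κ)) + 1 := by
  unfold supNorm
  refine Finset.sup'_le _ _ fun i _ => ?_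
  have hle : ((|quo N (x - (s : ℤ) • unitVec κ) i| : ℤ) : ℝ)
      ≤ Finset.univ.sup' Finset.univ_nonempty (fun i => ((|quo N (x - (s : ℤ) • unitVec κ) i| : ℤ) : ℝ)) :=
    Finset.le_sup' (fun i => ((|quo N (x - (s : ℤ) • unitVec κ) i| : ℤ) : ℝ)) (Finset.mem_univ i)
  have hcoord : |quo N x i| ≤ |quo N (x - (s : ℤ) • unitVec κ) i| + 1 := by
    simp only [quo, Pi.sub_apply, Pi.smul_apply, unitVec_apply, smul_eq_mul]
    by_cases hi : i = κ
    · rw [if_pos hi, mul_one]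
      obtain ⟨h1, h2⟩ := ediv_sub_bounds hN hs (x i)
      rw [abs_le]
      constructor
      · have := neg_abs_le ((x i - (s : ℤ)) / (N : ℤ)); linarith
      · have := le_abs_self ((x i - (s : ℤ)) / (N : ℤ)); linarith
    · rw [if_neg hi, mul_zero, sub_zero]; linarith [abs_nonneg (x i / (N : ℤ))]
  have hcast : ((|quo N x i| : ℤ) : ℝ) ≤ ((|quo N (x - (s : ℤ) • unitVec κ) i| : ℤ) : ℝ) + 1 := by exact_mod_cast hcoord
  linarith

/-! ## §2 The adjoint block sum of a decaying coarse form -/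

/-- [folklore] **`𝒬ᵀ` OF A COARSE 1-FORM WITH BLOCK-SCALE DECAY**: if `|φ κ y| ≤ B·e^{−κ₀‖y‖∞}` for all `κ, y` (`B ≥ 0`, `κ₀ ≥ 0`), then
`|(𝒬ᵀφ)_κ(x)| ≤ N·B·e^{κ₀}·e^{−κ₀‖quo_N x‖∞}` — `N` summands, each read at a block within sup-distance `1` of `quo_N x`. -/
theorem abs_contourSumAdj_le {N : ℕ} (hN : 0 < N) {φ : Form1 (d + 1) ℝ} {B κ₀ : ℝ} (hB : 0 ≤ B) (hκ : 0 ≤ κ₀)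
    (hφ : ∀ κ y, |φ κ y| ≤ B * Real.exp (-(κ₀ * supNorm y))) (κ : Fin (d + 1)) (x : Site (d + 1)) :
    |contourSumAdj N φ κ x| ≤ (N : ℝ) * B * Real.exp κ₀ * Real.exp (-(κ₀ * supNorm (quo N x))) := by
  unfold contourSumAdj
  have hterm : ∀ s ∈ Finset.range N,
      |φ κ (fun i => (x - (s : ℤ) • unitVec κ) i / (N : ℤ))| ≤ B * Real.exp κ₀ * Real.exp (-(κ₀ * supNorm (quo N x))) := by
    intro s hs
    have hsN : s < N := Finset.mem_range.mp hs
    have hq : (fun i => (x - (s : ℤ) • unitVec κ) i / (N : ℤ)) = quo N (x - (s : ℤ) • unitVec κ) := rfl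
    rw [hq]
    refine (hφ κ _).trans ?_
    have hsup := supNorm_quo_le_succ hN hsN x κ
    rw [mul_assoc, ← Real.exp_add]
    refine mul_le_mul_of_nonneg_left (Real.exp_le_exp.mpr ?_) hB
    nlinarith
  calc |∑ s ∈ Finset.range N, φ κ (fun i => (x - (s : ℤ) • unitVec κ) i / (N : ℤ))|
      ≤ ∑ s ∈ Finset.range N, |φ κ (fun i => (x - (s : ℤ) • unitVec κ) i / (N : ℤ))| := Finset.abs_sum_le_sum_abs _ _
    _ ≤ ∑ _s ∈ Finset.range N, B * Real.exp κ₀ * Real.exp (-(κ₀ * supNorm (quo N x))) := Finset.sum_le_sum hterm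
    _ = (N : ℝ) * B * Real.exp κ₀ * Real.exp (-(κ₀ * supNorm (quo N x))) := by
        rw [Finset.sum_const, Finset.card_range, nsmul_eq_mul]; ring

/-! ## §3 `d = 3`: the level-uniform bound on `d*d wH`, unconditionally -/

section Four

variable {Lc : ℕ} [NeZero Lc]

/-- [folklore] **SKELETON LEAF E3.3 (SECOND THIRD) OF ROAD P3, UNCONDITIONAL AT `d + 1 = 4`**: ONE rate `κ₀ > 0` and ONE constant `C` such
that for EVERY level `N = Lc^(j+1)`, every fine site `x`, every source direction `l` and component `μ`,
`|curvAdj (curv (wH-column l)) μ x| ≤ C · ((Lc^(j+1))^5)⁻¹ · ((Lc^(j+1))^2)⁻¹ · e^{−κ₀‖quo (Lc^(j+1)) x‖∞}` — `d*d` of the fine minimiser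
column of Bałaban's typed `U = 1` block-spin map is `O(N^{−(d+2)}·N^{−2})` pointwise with exponential decay on the block scale, uniformly
in the level (inputs: an5's gauge-free EL identity `ResolventComposition.wH_EL'` and road P3's `exists_wΦ_decay` BY NAME).  Read through the
units dictionary (`h = N^5·wH`, `Δ^η = N²·Δ`): the `D*D𝐀 = (Δ^ξ − P₁)𝐀`-component (weak Landau gauge, [I] p. 272) of the (4.4)-norm of the
test configuration is LEVEL-UNIFORMLY bounded. -/
theorem exists_curvAdj_curv_wH_decay :
    ∃ κ₀ C : ℝ, 0 < κ₀ ∧ 0 ≤ C ∧ ∀ (j : ℕ) (l μ : Fin 4) (x : Fin 4 → ℤ),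
      |curvAdj (curv (fun κ z => wH (N := Lc ^ (j + 1)) κ l z)) μ x|
        ≤ C * (((Lc ^ (j + 1) : ℕ) : ℝ) ^ 5)⁻¹ * (((Lc ^ (j + 1) : ℕ) : ℝ) ^ 2)⁻¹ *
          Real.exp (-(κ₀ * supNorm (quo (Lc ^ (j + 1)) x))) := by
  obtain ⟨κ₀, C, hκ₀, hC, h⟩ := exists_wΦ_decay (Lc := Lc)
  refine ⟨κ₀, C * Real.exp κ₀, hκ₀, by positivity, fun j l μ x => ?_⟩
  haveI : NeZero (Lc ^ (j + 1)) := ⟨pow_ne_zero _ (NeZero.ne Lc)⟩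
  have hNpos : 0 < Lc ^ (j + 1) := pow_pos (Nat.pos_of_ne_zero (NeZero.ne Lc)) _
  set Nr : ℝ := ((Lc ^ (j + 1) : ℕ) : ℝ) with hNr
  have hNr0 : 0 < Nr := by rw [hNr]; exact_mod_cast hNpos
  -- the gauge-free Euler–Lagrange identity: d*d wH = 𝒬ᵀ wΦ
  rw [wH_EL' (N := Lc ^ (j + 1)) l μ x]
  -- the multiplier bound at this level, in the shape of §2
  have hφ : ∀ κ y, |(fun κ y => wΦ (N := Lc ^ (j + 1)) κ l y) κ y|
      ≤ C * (Nr ^ 5)⁻¹ * (Nr ^ 3)⁻¹ * Real.exp (-(κ₀ * supNorm y)) := fun κ y => h j κ l y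
  have hB : 0 ≤ C * (Nr ^ 5)⁻¹ * (Nr ^ 3)⁻¹ := by positivity
  have hsum := abs_contourSumAdj_le (d := 3) hNpos hB hκ₀.le hφ μ x
  refine hsum.trans (le_of_eq ?_)
  rw [← hNr]
  field_simp

end Four

end Summit.QuantumFields.BalabanUV.Beta.RemainderExplicitLaplacian

end
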